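/-
Copyright (c) 2026 the pub-hodgecm-mathlib formalisation cell (harness21).  Prover seat hodgecm-mathlib-K2Liu-p05 (g0): Track B «K2-LIT»,
#184♮ = hLiu418 = stmt-HodgeConjecture-24832; socket #32d `sig_K2LiuDoublingHeightDecayLocal` of `Cruxes/HLiu418/Lines/K2_Liu_CurveThetaSigs_U5d_ZetaS.lean`
(ED. 1 a836627a4002dcd3 :224) — first step shared by every one-place slice organ ((B∞), (Bv-split), (Bv-nonsplit)); K2/STATUS 2026-09-04 (K2Liu-p05 (g0)).
-/
import Summits.HodgeConjecture.HodgeConjecture.Theorems.K2LiuDoublingHeightQuasiFactorization   -- ★ `exists_apply_mul_le_mul`; ★ (I) `exists_isCompact_isSiegelDelta_mul`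
import Literature.NumberTheory.K2Lit.LocalDoublingZeta                                           -- ★ D7b: `placesEmbed ∕ continuous_placesEmbed`
import Literature.NumberTheory.K2Lit.DoublingEmbedding                                           -- ★ `iotaV ∕ iotaLeft ∕ iotaV_eq_mul ∕ iotaV_diag ∕ isSiegelDelta_iotaV_diag`
import HarnessLib

/-!
# Crux `HLiu418`, road `K2_Liu`, unit U5d, socket #32d — the one-place slices of a `P_Δ`-height are QUASI-BI-INVARIANT under compact sets

Cell `hodgecm-mathlib`, crux item hLiu418 = `stmt-HodgeConjecture-24832`; squad K2 ∕ K2Liu, LEAD F0P6-plan (g10), planner K2Liu-plan (g2), prover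
K2Liu-p05 (g0).  THEOREMS ONLY (no `def` ∕ instance ∕ notation ∕ named-fact hypothesis ∕ `sorry`, default heartbeats); lane
`--supports stmt-HodgeConjecture-24832 --as helper` (count-neutral).

After organ (R) (★ `K2LiuDoublingHeightDecayLocalOfSlices.doublingHeightDecayLocal_of_slices`) socket #32d is the conjunction of its ONE-PLACE SLICES
`ψ_∞(a) = Φ(ι(ιA placesEmbed(a, 1), 1))` on `G_∞` and `ψ_v(u) = Φ(ι(ιA placesEmbed(1, (u at v)), 1))` on `G_v` (`v ∈ S`).  Every local road to their
integrability (Cartan `G_v = ⊔ K t_a K`, archimedean `KA⁺K`) starts with the same reduction, proved here once for all place types: **the slices are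
quasi-bi-invariant — `c⁻¹ ψ(u) ≤ ψ(k u k′) ≤ c ψ(u)` for `k, k′` in any compact sets** ([GelbartPiatetskishapiroRallis1987, Part A §2, §6]; [Li1992, §3];
[Garrett2018, §3.10]).

* §1 `exists_right_quasiInvariant` — RIGHT translation by a compact set `C ⊆ H(𝔸)`: `c⁻¹ Φ(x) ≤ Φ(x κ) ≤ c Φ(x)` (`x = p k` global Iwasawa ★ (I),
  `Φ(x κ)∕Φ(x) = Φ(k κ)∕Φ(k)` on the compact `K × C`; needs `dV i ≠ 0`, `dW i ≠ 0`).
* §2 LEFT translation along the doubling embedding costs nothing: `ι(κ y, 1) = ι(κ, κ)·ι(y, κ⁻¹)` with `ι(κ, κ) ∈ P_Δ(𝔸)` of modulus `1`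
  (★ `isSiegelDelta_iotaV_diag`, ★ `modDelta_diagG`), so `Φ(ι(κ y, 1)) = Φ(ι(y, 1)·ι(1, κ⁻¹))` (`apply_iotaV_mul_left`) — left becomes right;
  `exists_iotaV_quasiBiInvariant`: `Φ(ι(κ₁ y κ₂, 1)) ≍ Φ(ι(y, 1))` for `κ₁ ∈ C₁`, `κ₂ ∈ C₂` compact in `U(V)(𝔸)`.
* §3 THE SLICES (`ιA` continuous — in the socket's frame this is the ★ similitude bridge `exists_continuousMulEquiv_eq_iotaA`):
  `exists_placeSlice_quasiBiInvariant` (`ψ_v(k u k′) ≍ ψ_v(u)`, `k ∈ C₁`, `k′ ∈ C₂` compact in `G_v`) and `exists_archSlice_quasiBiInvariant` (the same on `G_∞`).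

HONEST LABEL.  Count-neutral helper (first step of the slice organs of #32d; it pays nothing by itself): `HC_CM` is proved only modulo the 7 printed
citations (2 remaining named inputs: hLiu418 = `stmt-HodgeConjecture-24832`, h413 = `stmt-HodgeConjecture-24833`) until rung 0 closes.
References: [GelbartPiatetskishapiroRallis1987] LNM 1254, Part A §2, §6; [Li1992] J. reine angew. Math. 428, §3 Thm. 3.1; [Garrett2018] §3.10;
[HarrisKudlaSweet1996] JAMS 9, §1 (1.11)–(1.12); [BorelJacquet1979] PSPM 33.1, §4.1.
-/

set_option autoImplicit false
-- the mandated namespace repeats the single-problem summit's segment (`HodgeConjecture.HodgeConjecture`)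
set_option linter.dupNamespace false

noncomputable section

open scoped Matrix
open NumberField IsDedekindDomain

namespace Summit.HodgeConjecture.HodgeConjecture.Cruxes.HLiu418.K2LiuDoublingHeightSliceQuasiInvariance

open Literature.NumberTheory.Automorphic Literature.NumberTheory.Automorphic.UnitaryGroup
open Literature.NumberTheory.GelbartRogawski1991 Literature.NumberTheory.GelbartRogawski1991.GRConstruction
open Literature.NumberTheory.K2Lit.SiegelDoubled Literature.NumberTheory.K2Lit.PlaceSplitting
open Summit.HodgeConjecture.HodgeConjecture.Cruxes.HLiu418.K2LiuDoublingHeightQuasiFactorization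
open Summit.HodgeConjecture.HodgeConjecture.Cruxes.HLiu418.K2LiuSiegelDoubledIwasawaCompact

variable (L : Type) [Field L] [NumberField L] [IsCMField L]
variable {N M n : ℕ} (e : Fin N × Fin M ≃ Fin n)
  (dV : Fin N → L) (hdV : ∀ i, IsCMField.complexConj L (dV i) = dV i)
  (dW : Fin M → L) (hdW : ∀ i, IsCMField.complexConj L (dW i) = dW i)

/-! ## §1 Right translation by a compact set -/

/-- a continuous positive function is bounded above and bounded away from `0` on a compact set: `Φ ≤ B` and `Φ⁻¹ ≤ B` on `C`, `B > 0`
(no non-emptiness needed). [cite: Garrett2018, §3.10] -/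
theorem exists_bound_and_inv_bound {Φ : HA L e dV hdV dW hdW → ℝ} (hΦc : Continuous Φ) (hΦpos : ∀ x, 0 < Φ x)
    {C : Set (HA L e dV hdV dW hdW)} (hC : IsCompact C) :
    ∃ B : ℝ, 0 < B ∧ ∀ κ ∈ C, Φ κ ≤ B ∧ (Φ κ)⁻¹ ≤ B := by
  obtain ⟨B₁, hB₁⟩ := hC.exists_bound_of_continuousOn hΦc.continuousOn
  obtain ⟨B₂, hB₂⟩ := hC.exists_bound_of_continuousOn ((hΦc.inv₀ fun x => (hΦpos x).ne').continuousOn)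
  refine ⟨max (max B₁ B₂) 1, lt_of_lt_of_le one_pos (le_max_right _ _), fun κ hκ => ⟨?_, ?_⟩⟩
  · have h := hB₁ κ hκ
    rw [Real.norm_eq_abs] at h
    exact ((le_abs_self _).trans h).trans ((le_max_left _ _).trans (le_max_left _ _))
  · have h := hB₂ κ hκ
    rw [Real.norm_eq_abs] at h
    exact ((le_abs_self _).trans h).trans ((le_max_right _ _).trans (le_max_left _ _))

/-- **RIGHT QUASI-INVARIANCE.**  For non-degenerate data, a continuous height `Φ > 0` of type `(P_Δ, modDelta)` on `H(𝔸)` and a compact `C ⊆ H(𝔸)`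
there is `c > 0` with `Φ(x κ) ≤ c Φ(x)` and `Φ(x) ≤ c Φ(x κ)` for all `x ∈ H(𝔸)`, `κ ∈ C` (global Iwasawa `x = p k`, ★ `exists_isCompact_isSiegelDelta_mul`:
`Φ(x κ)∕Φ(x) = Φ(k κ)∕Φ(k)`, and ★ `exists_apply_mul_le_mul` on `K × C`). [cite: Garrett2018, §3.10] [cite: GelbartPiatetskishapiroRallis1987, Part A §2] -/
theorem exists_right_quasiInvariant (hdV0 : ∀ i, dV i ≠ 0) (hdW0 : ∀ i, dW i ≠ 0)
    {Φ : HA L e dV hdV dW hdW → ℝ} (hΦc : Continuous Φ) (hΦpos : ∀ x, 0 < Φ x)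
    (hΦ : ∀ p x : HA L e dV hdV dW hdW, IsSiegelDelta L e dV hdV dW hdW p →
      Φ (p * x) = modDelta L e dV hdV dW hdW p * Φ x)
    {C : Set (HA L e dV hdV dW hdW)} (hC : IsCompact C) :
    ∃ c : ℝ, 0 < c ∧ ∀ (x : HA L e dV hdV dW hdW), ∀ κ ∈ C, Φ (x * κ) ≤ c * Φ x ∧ Φ x ≤ c * Φ (x * κ) := by
  obtain ⟨K, hK, hIw⟩ := exists_isCompact_isSiegelDelta_mul L e dV hdV dW hdW hdV0 hdW0
  obtain ⟨C₁, hC₁, hKC⟩ := exists_apply_mul_le_mul L e dV hdV dW hdW hΦc hΦpos hK hC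
  obtain ⟨B, hB, hBC⟩ := exists_bound_and_inv_bound L e dV hdV dW hdW hΦc hΦpos hC
  refine ⟨C₁ * B, mul_pos hC₁ hB, fun x κ hκ => ?_⟩
  obtain ⟨p, k, hp, hk, rfl⟩ := hIw x
  have hm : 0 ≤ modDelta L e dV hdV dW hdW p := (modDelta_pos L e dV hdV dW hdW p).le
  rw [mul_assoc, hΦ p _ hp, hΦ p _ hp]
  have h₁ := (hKC k hk κ hκ).1
  have h₂ := (hKC k hk κ hκ).2
  have hκB := (hBC κ hκ).1
  have hκB' := (hBC κ hκ).2
  constructor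
  · -- `Φ(kκ) ≤ C₁ Φ(k) Φ(κ) ≤ C₁ B Φ(k)`
    have hkk : Φ (k * κ) ≤ C₁ * B * Φ k := by
      calc Φ (k * κ) ≤ C₁ * (Φ k * Φ κ) := h₁
        _ ≤ C₁ * (Φ k * B) := mul_le_mul_of_nonneg_left (mul_le_mul_of_nonneg_left hκB (hΦpos k).le) hC₁.le
        _ = C₁ * B * Φ k := by ring
    calc modDelta L e dV hdV dW hdW p * Φ (k * κ) ≤ modDelta L e dV hdV dW hdW p * (C₁ * B * Φ k) :=
          mul_le_mul_of_nonneg_left hkk hm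
      _ = C₁ * B * (modDelta L e dV hdV dW hdW p * Φ k) := by ring
  · -- `Φ(k) = Φ(k)Φ(κ)·Φ(κ)⁻¹ ≤ C₁ Φ(kκ) · B`
    have hkk : Φ k ≤ C₁ * B * Φ (k * κ) := by
      have hΦκ : 0 < Φ κ := hΦpos κ
      calc Φ k = Φ k * Φ κ * (Φ κ)⁻¹ := by rw [mul_assoc, mul_inv_cancel₀ hΦκ.ne', mul_one]
        _ ≤ C₁ * Φ (k * κ) * B := mul_le_mul h₂ hκB' (inv_nonneg.2 hΦκ.le) (mul_nonneg hC₁.le (hΦpos _).le)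
        _ = C₁ * B * Φ (k * κ) := by ring
    calc modDelta L e dV hdV dW hdW p * Φ k ≤ modDelta L e dV hdV dW hdW p * (C₁ * B * Φ (k * κ)) :=
          mul_le_mul_of_nonneg_left hkk hm
      _ = C₁ * B * (modDelta L e dV hdV dW hdW p * Φ (k * κ)) := by ring

/-! ## §2 Left translation along the doubling embedding is right translation: `ι(κ y, 1) = ι(κ, κ)·ι(y, 1)·ι(1, κ⁻¹)` -/

/-- **`Φ(ι(κ y, 1)) = Φ(ι(y, 1)·ι(1, κ⁻¹))`**: `ι(κ y, 1) = ι(κ, κ)·ι(y, κ⁻¹)`, `ι(κ, κ) ∈ P_Δ(𝔸)` (★ `isSiegelDelta_iotaV_diag`) has modulus `1`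
(★ `modDelta_diagG`), and `ι(y, κ⁻¹) = ι(y, 1)·ι(1, κ⁻¹)` (★ `iotaV_eq_mul`). [cite: HarrisKudlaSweet1996, §1 (1.11)–(1.12)] [cite: GelbartPiatetskishapiroRallis1987, Part A §2] -/
theorem apply_iotaV_mul_left (hdV0 : ∀ i, dV i ≠ 0) (hdW0 : ∀ i, dW i ≠ 0)
    {Φ : HA L e dV hdV dW hdW → ℝ}
    (hΦ : ∀ p x : HA L e dV hdV dW hdW, IsSiegelDelta L e dV hdV dW hdW p →
      Φ (p * x) = modDelta L e dV hdV dW hdW p * Φ x)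
    (κ y : UnitaryGroup.adelic (Fp L) L (IsCMField.complexConj L) N (Matrix.diagonal dV)) :
    Φ (iotaV L e dV hdV dW hdW (κ * y, 1)) = Φ (iotaV L e dV hdV dW hdW (y, 1) * iotaV L e dV hdV dW hdW (1, κ⁻¹)) := by
  have hsplit : iotaV L e dV hdV dW hdW (κ * y, 1) = iotaV L e dV hdV dW hdW (κ, κ) * iotaV L e dV hdV dW hdW (y, κ⁻¹) := by
    rw [← map_mul, Prod.mk_mul_mk, mul_inv_cancel]
  rw [hsplit, hΦ _ _ (isSiegelDelta_iotaV_diag L e dV hdV dW hdW κ), iotaV_diag,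
    modDelta_diagG L e dV hdV hdV0 dW hdW hdW0, one_mul, iotaV_eq_mul]

/-- **QUASI-BI-INVARIANCE ALONG THE DOUBLING EMBEDDING.**  For compact `C₁, C₂ ⊆ U(V)(𝔸)` there is `c > 0` with
`Φ(ι(κ₁ y κ₂, 1)) ≤ c Φ(ι(y, 1))` and `Φ(ι(y, 1)) ≤ c Φ(ι(κ₁ y κ₂, 1))` for all `y`, `κ₁ ∈ C₁`, `κ₂ ∈ C₂` (§2 + §1 twice, on the compacts `ι(C₂, 1)` and
`ι(1, C₁⁻¹)`). [cite: GelbartPiatetskishapiroRallis1987, Part A §2] [cite: Li1992, §3 Thm. 3.1] -/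
theorem exists_iotaV_quasiBiInvariant (hdV0 : ∀ i, dV i ≠ 0) (hdW0 : ∀ i, dW i ≠ 0)
    {Φ : HA L e dV hdV dW hdW → ℝ} (hΦc : Continuous Φ) (hΦpos : ∀ x, 0 < Φ x)
    (hΦ : ∀ p x : HA L e dV hdV dW hdW, IsSiegelDelta L e dV hdV dW hdW p →
      Φ (p * x) = modDelta L e dV hdV dW hdW p * Φ x)
    {C₁ C₂ : Set (UnitaryGroup.adelic (Fp L) L (IsCMField.complexConj L) N (Matrix.diagonal dV))}
    (hC₁ : IsCompact C₁) (hC₂ : IsCompact C₂) :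
    ∃ c : ℝ, 0 < c ∧ ∀ (y : UnitaryGroup.adelic (Fp L) L (IsCMField.complexConj L) N (Matrix.diagonal dV)), ∀ κ₁ ∈ C₁, ∀ κ₂ ∈ C₂,
      Φ (iotaV L e dV hdV dW hdW (κ₁ * y * κ₂, 1)) ≤ c * Φ (iotaV L e dV hdV dW hdW (y, 1)) ∧
        Φ (iotaV L e dV hdV dW hdW (y, 1)) ≤ c * Φ (iotaV L e dV hdV dW hdW (κ₁ * y * κ₂, 1)) := by
  -- the two compacts of `H(𝔸)`: `ι(C₂, 1)` and `ι(1, C₁⁻¹)`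
  have hD₂ : IsCompact ((fun κ => iotaV L e dV hdV dW hdW (κ, 1)) '' C₂) :=
    hC₂.image ((continuous_iotaV L e dV hdV dW hdW).comp (continuous_id.prodMk continuous_const))
  have hD₁ : IsCompact ((fun κ => iotaV L e dV hdV dW hdW (1, κ⁻¹)) '' C₁) :=
    hC₁.image ((continuous_iotaV L e dV hdV dW hdW).comp (continuous_const.prodMk continuous_inv))
  obtain ⟨c₂, hc₂, h₂⟩ := exists_right_quasiInvariant L e dV hdV dW hdW hdV0 hdW0 hΦc hΦpos hΦ hD₂
  obtain ⟨c₁, hc₁, h₁⟩ := exists_right_quasiInvariant L e dV hdV dW hdW hdV0 hdW0 hΦc hΦpos hΦ hD₁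
  refine ⟨c₁ * c₂, mul_pos hc₁ hc₂, fun y κ₁ hκ₁ κ₂ hκ₂ => ?_⟩
  -- left: `Φ(ι(κ₁ (y κ₂), 1)) = Φ(ι(y κ₂, 1)·ι(1, κ₁⁻¹)) ≍ Φ(ι(y κ₂, 1))`; right: `ι(y κ₂, 1) = ι(y, 1)·ι(κ₂, 1)`
  have hL := h₁ (iotaV L e dV hdV dW hdW (y * κ₂, 1)) _ (Set.mem_image_of_mem _ hκ₁)
  have hR := h₂ (iotaV L e dV hdV dW hdW (y, 1)) _ (Set.mem_image_of_mem _ hκ₂)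
  have hyκ : iotaV L e dV hdV dW hdW (y * κ₂, 1) = iotaV L e dV hdV dW hdW (y, 1) * iotaV L e dV hdV dW hdW (κ₂, 1) := by
    rw [← map_mul, Prod.mk_mul_mk, mul_one]
  rw [mul_assoc, apply_iotaV_mul_left L e dV hdV dW hdW hdV0 hdW0 hΦ κ₁ (y * κ₂)]
  rw [hyκ] at hL ⊢
  constructor
  · calc Φ (iotaV L e dV hdV dW hdW (y, 1) * iotaV L e dV hdV dW hdW (κ₂, 1) * iotaV L e dV hdV dW hdW (1, κ₁⁻¹))
        ≤ c₁ * Φ (iotaV L e dV hdV dW hdW (y, 1) * iotaV L e dV hdV dW hdW (κ₂, 1)) := hL.1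
      _ ≤ c₁ * (c₂ * Φ (iotaV L e dV hdV dW hdW (y, 1))) := mul_le_mul_of_nonneg_left hR.1 hc₁.le
      _ = c₁ * c₂ * Φ (iotaV L e dV hdV dW hdW (y, 1)) := by ring
  · calc Φ (iotaV L e dV hdV dW hdW (y, 1)) ≤ c₂ * Φ (iotaV L e dV hdV dW hdW (y, 1) * iotaV L e dV hdV dW hdW (κ₂, 1)) := hR.2
      _ ≤ c₂ * (c₁ * Φ (iotaV L e dV hdV dW hdW (y, 1) * iotaV L e dV hdV dW hdW (κ₂, 1) * iotaV L e dV hdV dW hdW (1, κ₁⁻¹))) :=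
          mul_le_mul_of_nonneg_left hL.2 hc₂.le
      _ = c₁ * c₂ * Φ (iotaV L e dV hdV dW hdW (y, 1) * iotaV L e dV hdV dW hdW (κ₂, 1) * iotaV L e dV hdV dW hdW (1, κ₁⁻¹)) := by
          ring

/-! ## §3 The one-place slices of socket #32d are quasi-bi-invariant -/

section Slices

variable (H : Matrix (Fin N) (Fin N) L)
  (ιA : (UnitaryGroup.adelicGroupData (Fp L) L (IsCMField.complexConj L) N H).Adelic →*
    UnitaryGroup.adelic (Fp L) L (IsCMField.complexConj L) N (Matrix.diagonal dV))
  (S : Finset (HeightOneSpectrum (𝓞 (Fp L)))) [DecidableEq (HeightOneSpectrum (𝓞 (Fp L)))]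

/-- **THE `v`-SLICE IS QUASI-BI-INVARIANT**: for `v ∈ S`, compact `C₁, C₂ ⊆ G_v = U(H)(L⁺_v)` and `ψ_v(u) = Φ(ι(ιA placesEmbed(1, (u at v)), 1))` there is
`c > 0` with `ψ_v(k u k′) ≤ c ψ_v(u)` and `ψ_v(u) ≤ c ψ_v(k u k′)` for all `u`, `k ∈ C₁`, `k′ ∈ C₂` (`ιA`, `placesEmbed` and `u ↦ (u at v)` are
continuous homomorphisms, so this is §2 on the compact images). [cite: Li1992, §3 Thm. 3.1] [cite: GelbartPiatetskishapiroRallis1987, Part A §6] -/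
theorem exists_placeSlice_quasiBiInvariant (hdV0 : ∀ i, dV i ≠ 0) (hdW0 : ∀ i, dW i ≠ 0) (hιAc : Continuous ιA) (v : S)
    {Φ : HA L e dV hdV dW hdW → ℝ} (hΦc : Continuous Φ) (hΦpos : ∀ x, 0 < Φ x)
    (hΦ : ∀ p x : HA L e dV hdV dW hdW, IsSiegelDelta L e dV hdV dW hdW p →
      Φ (p * x) = modDelta L e dV hdV dW hdW p * Φ x)
    {C₁ C₂ : Set (UnitaryGroup.localPi L (IsCMField.complexConj L) N H v.1)} (hC₁ : IsCompact C₁) (hC₂ : IsCompact C₂) :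
    ∃ c : ℝ, 0 < c ∧ ∀ (u : UnitaryGroup.localPi L (IsCMField.complexConj L) N H v.1), ∀ k ∈ C₁, ∀ k' ∈ C₂,
      Φ (iotaLeft L e dV hdV dW hdW (ιA (placesEmbed L H S (1, Pi.mulSingle v (k * u * k'))))) ≤
          c * Φ (iotaLeft L e dV hdV dW hdW (ιA (placesEmbed L H S (1, Pi.mulSingle v u)))) ∧
        Φ (iotaLeft L e dV hdV dW hdW (ιA (placesEmbed L H S (1, Pi.mulSingle v u)))) ≤
          c * Φ (iotaLeft L e dV hdV dW hdW (ιA (placesEmbed L H S (1, Pi.mulSingle v (k * u * k'))))) := by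
  -- `A : u ↦ ιA placesEmbed(1, (u at v))` is multiplicative and continuous
  have hAmul : ∀ x y : UnitaryGroup.localPi L (IsCMField.complexConj L) N H v.1,
      ιA (placesEmbed L H S (1, Pi.mulSingle v (x * y))) =
        ιA (placesEmbed L H S (1, Pi.mulSingle v x)) * ιA (placesEmbed L H S (1, Pi.mulSingle v y)) := fun x y => by
    rw [← map_mul, ← map_mul, Prod.mk_mul_mk, mul_one, ← Pi.mulSingle_mul]
  have hAc : Continuous fun x : UnitaryGroup.localPi L (IsCMField.complexConj L) N H v.1 =>
      ιA (placesEmbed L H S (1, Pi.mulSingle v x)) :=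
    hιAc.comp ((continuous_placesEmbed L H S).comp (continuous_const.prodMk
      (continuous_mulSingle (A := fun w : S => UnitaryGroup.localPi L (IsCMField.complexConj L) N H w.1) v)))
  obtain ⟨c, hc, h⟩ := exists_iotaV_quasiBiInvariant L e dV hdV dW hdW hdV0 hdW0 hΦc hΦpos hΦ (hC₁.image hAc) (hC₂.image hAc)
  refine ⟨c, hc, fun u k hk k' hk' => ?_⟩
  rw [iotaLeft_apply, iotaLeft_apply, hAmul, hAmul]
  exact h _ _ (Set.mem_image_of_mem _ hk) _ (Set.mem_image_of_mem _ hk')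

/-- **THE ARCHIMEDEAN SLICE IS QUASI-BI-INVARIANT**: for compact `C₁, C₂ ⊆ G_∞ = U(H)(L⁺ ⊗ ℝ)` and `ψ_∞(a) = Φ(ι(ιA placesEmbed(a, 1), 1))` there is `c > 0`
with `ψ_∞(k a k′) ≤ c ψ_∞(a)` and `ψ_∞(a) ≤ c ψ_∞(k a k′)` for all `a`, `k ∈ C₁`, `k′ ∈ C₂`. [cite: GelbartPiatetskishapiroRallis1987, Part A §6] [cite: Garrett2018, §3.10] -/
theorem exists_archSlice_quasiBiInvariant (hdV0 : ∀ i, dV i ≠ 0) (hdW0 : ∀ i, dW i ≠ 0) (hιAc : Continuous ιA)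
    {Φ : HA L e dV hdV dW hdW → ℝ} (hΦc : Continuous Φ) (hΦpos : ∀ x, 0 < Φ x)
    (hΦ : ∀ p x : HA L e dV hdV dW hdW, IsSiegelDelta L e dV hdV dW hdW p →
      Φ (p * x) = modDelta L e dV hdV dW hdW p * Φ x)
    {C₁ C₂ : Set (UnitaryGroup.arch (Fp L) L (IsCMField.complexConj L) N H)} (hC₁ : IsCompact C₁) (hC₂ : IsCompact C₂) :
    ∃ c : ℝ, 0 < c ∧ ∀ (a : UnitaryGroup.arch (Fp L) L (IsCMField.complexConj L) N H), ∀ k ∈ C₁, ∀ k' ∈ C₂,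
      Φ (iotaLeft L e dV hdV dW hdW (ιA (placesEmbed L H S (k * a * k', 1)))) ≤
          c * Φ (iotaLeft L e dV hdV dW hdW (ιA (placesEmbed L H S (a, 1)))) ∧
        Φ (iotaLeft L e dV hdV dW hdW (ιA (placesEmbed L H S (a, 1)))) ≤
          c * Φ (iotaLeft L e dV hdV dW hdW (ιA (placesEmbed L H S (k * a * k', 1)))) := by
  have hAmul : ∀ x y : UnitaryGroup.arch (Fp L) L (IsCMField.complexConj L) N H,
      ιA (placesEmbed L H S (x * y, 1)) = ιA (placesEmbed L H S (x, 1)) * ιA (placesEmbed L H S (y, 1)) := fun x y => by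
    rw [← map_mul, ← map_mul, Prod.mk_mul_mk, mul_one]
  have hAc : Continuous fun x : UnitaryGroup.arch (Fp L) L (IsCMField.complexConj L) N H => ιA (placesEmbed L H S (x, 1)) :=
    hιAc.comp ((continuous_placesEmbed L H S).comp (continuous_id.prodMk continuous_const))
  obtain ⟨c, hc, h⟩ := exists_iotaV_quasiBiInvariant L e dV hdV dW hdW hdV0 hdW0 hΦc hΦpos hΦ (hC₁.image hAc) (hC₂.image hAc)
  refine ⟨c, hc, fun a k hk k' hk' => ?_⟩
  rw [iotaLeft_apply, iotaLeft_apply, hAmul, hAmul]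
  exact h _ _ (Set.mem_image_of_mem _ hk) _ (Set.mem_image_of_mem _ hk')

end Slices

end Summit.HodgeConjecture.HodgeConjecture.Cruxes.HLiu418.K2LiuDoublingHeightSliceQuasiInvariance

end
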